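import Mathlib
import HarnessLib
import Summits.HubbardSuperconductivity.HubbardSuperconductivity.Theorems.KLProgrammeC4aPPKernelStripEnvelope
import Summits.HubbardSuperconductivity.HubbardSuperconductivity.Theorems.KLProgrammeC4aPPKernelTrueSplitKernel
import Summits.HubbardSuperconductivity.HubbardSuperconductivity.Theorems.KLProgrammeC4aPPKernelNegPreThermal

/-!
# Route `KLProgramme` — crux C4a, S3 brick (B4) «(B4)-UMK1», «(M1)-FAMILY» part 1: ONE kernel family for every signed loop level — the true pp kernel with the
# finer-line split FLOORED AT THE SCALE, `Kr(e,u) = P(e,u)·κ(m/(m+|u|))`, `m = max(|e|, lo)` — its partner derivative, `C¹`, the envelopes `hK0/hK1` for every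
# `e ≠ 0`, and the scale-regular STRIP envelope `hKs1`

Cell `gate-hubbard-kl`, seat hubbard-kl-k3c3-p1 (g16; row «δμ-flow with klAngularMean constant piece»).  Located brick for the (C)-closer lane's one-call row bundle
`…C4aFoldBoxLawRows.foldBox_law_rows` (k3c3-p3 g32, p687040): it takes ONE `Kr : ℝ → ℝ → ℝ` (signed loop level ↦ partner kernel) with rows `hKd/hK0/hK1` (`e ≠ 0`),
`hKs1` (strip `|e| ≤ lo`), `hKn1…hρtail` (`e < 0`), `hK2d/hK2/hsupp/hflat` (`e ∈ [lo,hi]`), `hKc` (joint continuity on `ℝ × ℝ`); stmt-HubbardSuperconductivity-20437 (C)/(U1);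
memo HOME/hubbard-kl-k3c3-p1/g16-M1-NEG-PRE-KERNEL.md §7 (located points (L1)–(L4) of the 02:05Z bus line).

WHY THIS FAMILY.  `hKc` forces one jointly-`C¹` family, i.e. the physical piece-A kernel `P·S_A`; the plain finer-line split `κ(|e|/(|e|+|u|))` is not scale-regular on the
strip (`∂ᵤκ ≍ κ₁|e|/(|e|+|u|)²`), so the split is FLOORED at the scale: `S(e,u) = κ(m/(m+|u|))`, `m = max(|e|,lo)` — for `|e| ≥ lo` the finer-line split, on the strip
`κ(lo/(lo+|u|))` (independent of `e`, `|∂ᵤS| ≤ κ₁/max(lo,|u|)`), a legitimate partition-of-unity choice (`1 − S` is «partner finer» only where `|u| ≲ m(1−t₁)/t₁`).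
* §1 **`abs_ppTrueKernel_le_four_div`** (`|P(e,u)| ≤ 4/Λ` for ALL levels — each live denominator is `≥ Λ²/4`), **`abs_ppTrueKernel_strip_le_inv_max`**
  (`|e| ≤ Λ ⟹ |P(e,u)| ≤ 8·(max Λ |u|)⁻¹`) — the strip VALUE envelope (companion of p686140's derivative envelope);
* §2 `ppFamilyKernel`, `familyScale` (`m`), **`hasDerivAt_ppFamilyKernel`** (`∂ᵤKr = ∂ᵤP·S + P·S′` everywhere, `S′ = deriv` of g15's split weight at scale `m`),
  `ppFamilyKernel_eq_zero_of_abs_le` (`|u| ≤ m(1−t₁) ⟹ Kr = 0`), **`contDiff_one_ppFamilyKernel`** (`hKd`, every `e`);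
* §3 **`abs_ppFamilyKernel_le`** (`hK0`: `e ≠ 0 ⟹ |Kr e u| ≤ κ₀(12B₁+9)·(max |e| |u|)⁻¹`), **`abs_deriv_ppFamilyKernel_le`** (`hK1`: `≤ C₁ᶠ·(max |e| |u|)⁻¹²`,
  `C₁ᶠ = κ₀(64B₂+96B₁+136+(12B₁+9)/c) + κ₁(12B₁+9)`, `c = min(1,(1−t₁)/t₁)`; negative levels by the parity `P(−e,−u) = P(e,u)`), **`abs_deriv_ppFamilyKernel_strip_le`**
  (`hKs1`: `|e| ≤ lo ≤ Λ ⟹ ≤ (κ₀(128B₁+72) + 8κ₁)·(max lo |u|)⁻¹²`).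
Parts 2–3 (`…FamilyNeg`, `…FamilySecond`): the diagonal majorant at negative levels, joint continuity, and the `[lo,hi]` rows (where `Kr = K⁺` on `u ≥ −e(1−t₁)/t₁`).
Pure real analysis on Literature objects; nothing asserts (C), K3, the window or superconductivity.
References: BGM 2006 §2.4 (2.36) [cite: BenfattoGiulianiMastropietro2006]; Salmhofer 1999 §4.2.5 (4.70)–(4.71) [cite: Salmhofer1999]; FST II CPAM 51 (1998) §3
[cite: FeldmanSalmhoferTrubowitz1998].
-/

noncomputable section

namespace Summit.HubbardSuperconductivity.HubbardSuperconductivity.Theorems.C4a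

set_option linter.dupNamespace false -- summit = problem name (single-conjunct summit), D-0017

open Real Filter Set
open scoped Topology
open Literature.MathematicalPhysics.QuantumLattice Literature.Analysis.SpecialFunctions

/-! ## §1 The strip VALUE envelope of `P` -/

/-- **`|P(e,u)| ≤ 4/Λ` for ALL levels** (`0 < β`, `0 < Λ`): each live summand is `≤ W(u)/(ω²+u²) + W(e)/(ω²+e²) ≤ 4/(ωₙ²+(Λ/2)²)`, summed counting-free.
[cite: BenfattoGiulianiMastropietro2006, §2.4 (2.36)] -/
theorem abs_ppTrueKernel_le_four_div {β Λ : ℝ} (hβ : 0 < β) (hΛ : 0 < Λ) (e u : ℝ) : |ppTrueKernel β Λ e u| ≤ 4 / Λ := by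
  unfold ppTrueKernel
  set f : ℕ → ℝ := fun n => uvWeightFn Λ (ppFreq β n) e * uvWeightFn Λ (ppFreq β n) u *
      ((e * u + ppFreq β n ^ 2) / ((ppFreq β n ^ 2 + e ^ 2) * (ppFreq β n ^ 2 + u ^ 2))) with hf
  have hbd : ∀ n : ℕ, |f n| ≤ 4 * (1 / (ppFreq β n ^ 2 + (Λ / 2) ^ 2)) := fun n => by
    have hω : ppFreq β n ≠ 0 := (ppFreq_pos hβ n).ne'
    obtain ⟨hWe0, hWe1⟩ := uvWeightFn_mem_Icc Λ (ppFreq β n) e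
    obtain ⟨hWu0, hWu1⟩ := uvWeightFn_mem_Icc Λ (ppFreq β n) u
    have hD0 : 0 < ppFreq β n ^ 2 + (Λ / 2) ^ 2 := by positivity
    have hcore := abs_pairSummand_core_le hω e u
    -- `W(u)/(ω²+u²) ≤ 2/(ω²+(Λ/2)²)` and `W(e)/(ω²+e²) ≤ 2/(ω²+(Λ/2)²)`
    have hWB : uvWeightFn Λ (ppFreq β n) u * (1 / (ppFreq β n ^ 2 + u ^ 2)) ≤ 2 / (ppFreq β n ^ 2 + (Λ / 2) ^ 2) := by
      by_cases hz : uvWeightFn Λ (ppFreq β n) u = 0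
      · rw [hz, zero_mul]; positivity
      · have hs := (inv_denominator_le_of_shell hΛ (sq_add_sq_ge_of_uvWeightFn_ne_zero hΛ hz)).1
        calc uvWeightFn Λ (ppFreq β n) u * (1 / (ppFreq β n ^ 2 + u ^ 2)) ≤ 1 * (2 / (ppFreq β n ^ 2 + (Λ / 2) ^ 2)) :=
              mul_le_mul hWu1 hs (by positivity) zero_le_one
          _ = _ := one_mul _
    have hWA : uvWeightFn Λ (ppFreq β n) e * (1 / (ppFreq β n ^ 2 + e ^ 2)) ≤ 2 / (ppFreq β n ^ 2 + (Λ / 2) ^ 2) := by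
      by_cases hz : uvWeightFn Λ (ppFreq β n) e = 0
      · rw [hz, zero_mul]; positivity
      · have hs := (inv_denominator_le_of_shell hΛ (sq_add_sq_ge_of_uvWeightFn_ne_zero hΛ hz)).1
        calc uvWeightFn Λ (ppFreq β n) e * (1 / (ppFreq β n ^ 2 + e ^ 2)) ≤ 1 * (2 / (ppFreq β n ^ 2 + (Λ / 2) ^ 2)) :=
              mul_le_mul hWe1 hs (by positivity) zero_le_one
          _ = _ := one_mul _
    rw [hf]
    simp only
    rw [abs_mul, abs_mul, abs_of_nonneg hWe0, abs_of_nonneg hWu0]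
    calc uvWeightFn Λ (ppFreq β n) e * uvWeightFn Λ (ppFreq β n) u * |(e * u + ppFreq β n ^ 2) / ((ppFreq β n ^ 2 + e ^ 2) * (ppFreq β n ^ 2 + u ^ 2))|
        ≤ uvWeightFn Λ (ppFreq β n) e * uvWeightFn Λ (ppFreq β n) u * (1 / (ppFreq β n ^ 2 + u ^ 2) + 1 / (ppFreq β n ^ 2 + e ^ 2)) :=
          mul_le_mul_of_nonneg_left hcore (by positivity)
      _ = uvWeightFn Λ (ppFreq β n) e * (uvWeightFn Λ (ppFreq β n) u * (1 / (ppFreq β n ^ 2 + u ^ 2))) +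
            uvWeightFn Λ (ppFreq β n) u * (uvWeightFn Λ (ppFreq β n) e * (1 / (ppFreq β n ^ 2 + e ^ 2))) := by ring
      _ ≤ 1 * (2 / (ppFreq β n ^ 2 + (Λ / 2) ^ 2)) + 1 * (2 / (ppFreq β n ^ 2 + (Λ / 2) ^ 2)) :=
          add_le_add (mul_le_mul hWe1 hWB (by positivity) zero_le_one) (mul_le_mul hWu1 hWA (by positivity) zero_le_one)
      _ = 4 * (1 / (ppFreq β n ^ 2 + (Λ / 2) ^ 2)) := by ring
  have hsb : Summable fun n : ℕ => 4 * (1 / (ppFreq β n ^ 2 + (Λ / 2) ^ 2)) := (summable_one_div_ppFreq_sq_add_sq hβ (Λ / 2)).mul_left 4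
  have hsf : Summable f := Summable.of_norm_bounded hsb fun n => by rw [Real.norm_eq_abs]; exact hbd n
  have htsum : |∑' n : ℕ, f n| ≤ 4 * (β * Real.tanh (β * (Λ / 2) / 2) / (4 * (Λ / 2))) := by
    rw [← tsum_one_div_ppFreq_sq_add_sq hβ (by positivity : Λ / 2 ≠ 0), ← tsum_mul_left]
    refine (norm_tsum_le_tsum_norm hsf.norm).trans ?_
    exact Summable.tsum_le_tsum (fun n => by rw [Real.norm_eq_abs]; exact hbd n) hsf.norm hsb
  have ht : Real.tanh (β * (Λ / 2) / 2) ≤ 1 := (Real.tanh_lt_one _).le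
  have hβ2 : 0 < 2 / β := by positivity
  rw [abs_mul, abs_of_pos hβ2]
  calc 2 / β * |∑' n : ℕ, f n| ≤ 2 / β * (4 * (β * Real.tanh (β * (Λ / 2) / 2) / (4 * (Λ / 2)))) := mul_le_mul_of_nonneg_left htsum hβ2.le
    _ = 4 / Λ * Real.tanh (β * (Λ / 2) / 2) := by field_simp; ring
    _ ≤ 4 / Λ * 1 := mul_le_mul_of_nonneg_left ht (by positivity)
    _ = 4 / Λ := mul_one _

/-- **THE STRIP VALUE ENVELOPE**: `|e| ≤ Λ ⟹ |P(e,u)| ≤ 8·(max Λ |u|)⁻¹` for every `u` (`|u| ≤ 2Λ` by §1's uniform `4/Λ`; `|u| ≥ 2Λ` by `P = N/(e+u)`,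
`|N| ≤ 1`, `|e+u| ≥ |u|/2`). [cite: BenfattoGiulianiMastropietro2006, §2.4 (2.36)] -/
theorem abs_ppTrueKernel_strip_le_inv_max {β Λ : ℝ} (hβ : 0 < β) (hΛ : 0 < Λ) {e : ℝ} (he : |e| ≤ Λ) (u : ℝ) :
    |ppTrueKernel β Λ e u| ≤ 8 * (max Λ |u|)⁻¹ := by
  set M : ℝ := max Λ |u| with hM
  have hMΛ : Λ ≤ M := le_max_left _ _
  have hM0 : 0 < M := hΛ.trans_le hMΛ
  rcases le_or_gt (2 * Λ) |u| with hfar | hnear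
  · have hu0 : 0 < |u| := by linarith
    have hsum : |u| / 2 ≤ |e + u| := by
      have h1 : |u| - |e| ≤ |e + u| := by
        have := abs_sub_abs_le_abs_sub u (-e)
        rw [abs_neg, sub_neg_eq_add, add_comm] at this
        exact this
      linarith
    have hne : e + u ≠ 0 := by intro h; rw [h, abs_zero] at hsum; linarith
    rw [ppTrueKernel_eq_div hβ Λ hne, abs_div]
    have hN := abs_ppTrueNumerator_le_one hβ Λ e u
    have hMu : M = |u| := max_eq_right (by linarith)
    rw [hMu]
    calc |ppTrueNumerator β Λ e u| / |e + u| ≤ 1 / (|u| / 2) := by gcongr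
      _ = 2 * |u|⁻¹ := by field_simp
      _ ≤ 8 * |u|⁻¹ := by gcongr; norm_num
  · have h := abs_ppTrueKernel_le_four_div hβ hΛ e u
    have hM2 : M ≤ 2 * Λ := max_le (by linarith) hnear.le
    have hinv : 1 / Λ ≤ 2 * M⁻¹ := by
      rw [← one_div, mul_one_div, div_le_div_iff₀ hΛ hM0]; linarith
    calc |ppTrueKernel β Λ e u| ≤ 4 / Λ := h
      _ = 4 * (1 / Λ) := by ring
      _ ≤ 4 * (2 * M⁻¹) := mul_le_mul_of_nonneg_left hinv (by norm_num)
      _ = 8 * M⁻¹ := by ring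

/-! ## §2 The family: definition, partner derivative, `C¹` -/

/-- The FLOOR SCALE of the split at loop level `e`: `m = max(|e|, lo)`. -/
def familyScale (lo e : ℝ) : ℝ := max |e| lo

/-- **The kernel family** `Kr(e,u) = P(e,u)·κ(m/(m+|u|))`, `m = max(|e|,lo)` — the true pp kernel with the finer-line split floored at the scale. -/
def ppFamilyKernel (β Λ : ℝ) (κ : ℝ → ℝ) (lo e u : ℝ) : ℝ :=
  ppTrueKernel β Λ e u * κ (familyScale lo e / (familyScale lo e + |u|))

/-- `m > 0` once `lo > 0`, and `|e| ≤ m`, `lo ≤ m`. [folklore] -/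
theorem familyScale_pos {lo : ℝ} (hlo : 0 < lo) (e : ℝ) : 0 < familyScale lo e ∧ |e| ≤ familyScale lo e ∧ lo ≤ familyScale lo e :=
  ⟨lt_max_of_lt_right hlo, le_max_left _ _, le_max_right _ _⟩

/-- On a level at or above the floor the scale is the level: `lo ≤ |e| ⟹ m = |e|`. [folklore] -/
theorem familyScale_eq_abs {lo e : ℝ} (h : lo ≤ |e|) : familyScale lo e = |e| := max_eq_left h

/-- On the strip the scale is the floor: `|e| ≤ lo ⟹ m = lo`. [folklore] -/
theorem familyScale_eq_floor {lo e : ℝ} (h : |e| ≤ lo) : familyScale lo e = lo := max_eq_right h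

/-- **`∂ᵤKr = ∂ᵤP·S + P·S′` everywhere** (`S(u) = κ(m/(m+|u|))` is g15's split weight at scale `m`; `S′ = deriv S`, which exists everywhere).
[cite: BenfattoGiulianiMastropietro2006, §2.4 (2.36)] -/
theorem hasDerivAt_ppFamilyKernel {β Λ : ℝ} (hβ : 0 < β) (hΛ : 0 < Λ) {B₁ : ℝ} (hB₁ : ∀ x, |deriv salmhoferCutoff x| ≤ B₁) {κ κ' : ℝ → ℝ}
    (hκ : ∀ t, HasDerivAt κ (κ' t) t) {t₁ : ℝ} (ht₁ : t₁ < 1) (hκs : ∀ t, t₁ ≤ t → κ t = 0) {lo : ℝ} (hlo : 0 < lo) (e u : ℝ) :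
    HasDerivAt (fun v : ℝ => ppFamilyKernel β Λ κ lo e v)
      (ppTrueKernelDu β Λ e u * κ (familyScale lo e / (familyScale lo e + |u|)) +
        ppTrueKernel β Λ e u * deriv (fun v : ℝ => κ (familyScale lo e / (familyScale lo e + |v|))) u) u := by
  have hm := (familyScale_pos hlo e).1
  have hP := hasDerivAt_ppTrueKernel_u hβ hΛ hB₁ e u
  have hS : HasDerivAt (fun v : ℝ => κ (familyScale lo e / (familyScale lo e + |v|)))
      (deriv (fun v : ℝ => κ (familyScale lo e / (familyScale lo e + |v|))) u) u := by
    rcases eq_or_ne u 0 with rfl | hu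
    · rw [(hasDerivAt_splitWeight_zero hm ht₁ hκs).deriv]; exact hasDerivAt_splitWeight_zero hm ht₁ hκs
    · rw [(hasDerivAt_splitWeight hκ hm hu).deriv]; exact hasDerivAt_splitWeight hκ hm hu
  exact hP.mul hS

/-- `deriv` form of `hasDerivAt_ppFamilyKernel`. [cite: BenfattoGiulianiMastropietro2006, §2.4 (2.36)] -/
theorem deriv_ppFamilyKernel {β Λ : ℝ} (hβ : 0 < β) (hΛ : 0 < Λ) {B₁ : ℝ} (hB₁ : ∀ x, |deriv salmhoferCutoff x| ≤ B₁) {κ κ' : ℝ → ℝ}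
    (hκ : ∀ t, HasDerivAt κ (κ' t) t) {t₁ : ℝ} (ht₁ : t₁ < 1) (hκs : ∀ t, t₁ ≤ t → κ t = 0) {lo : ℝ} (hlo : 0 < lo) (e u : ℝ) :
    deriv (fun v : ℝ => ppFamilyKernel β Λ κ lo e v) u =
      ppTrueKernelDu β Λ e u * κ (familyScale lo e / (familyScale lo e + |u|)) +
        ppTrueKernel β Λ e u * deriv (fun v : ℝ => κ (familyScale lo e / (familyScale lo e + |v|))) u :=
  (hasDerivAt_ppFamilyKernel hβ hΛ hB₁ hκ ht₁ hκs hlo e u).deriv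

/-- **The family vanishes near the Fermi level of the partner**: `|u| ≤ m(1−t₁) ⟹ Kr(e,u) = 0`. [folklore] -/
theorem ppFamilyKernel_eq_zero_of_abs_le {β Λ : ℝ} {κ : ℝ → ℝ} {t₁ lo e u : ℝ} (hlo : 0 < lo) (ht₁ : t₁ ≤ 1) (hκs : ∀ t, t₁ ≤ t → κ t = 0)
    (hu : |u| ≤ familyScale lo e * (1 - t₁)) : ppFamilyKernel β Λ κ lo e u = 0 := by
  unfold ppFamilyKernel
  rw [splitWeight_eq_zero_of_abs_le (familyScale_pos hlo e).1 ht₁ hκs hu, mul_zero]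

/-- **ROW `hKd` (every level)**: `u ↦ Kr(e,u)` is `C¹`. [cite: BenfattoGiulianiMastropietro2006, §2.4 (2.36)] -/
theorem contDiff_one_ppFamilyKernel {β Λ : ℝ} (hβ : 0 < β) (hΛ : 0 < Λ) {B₁ : ℝ} (hB₁ : ∀ x, |deriv salmhoferCutoff x| ≤ B₁) {κ κ' : ℝ → ℝ}
    (hκ : ∀ t, HasDerivAt κ (κ' t) t) (hκ'c : Continuous κ') {t₁ : ℝ} (ht₁ : t₁ < 1) (hκs : ∀ t, t₁ ≤ t → κ t = 0) {lo : ℝ} (hlo : 0 < lo) (e : ℝ) :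
    ContDiff ℝ 1 (fun v : ℝ => ppFamilyKernel β Λ κ lo e v) :=
  (contDiff_one_ppTrueKernel hβ hΛ hB₁ e).mul (contDiff_one_splitWeight hκ hκ'c ht₁ hκs (familyScale_pos hlo e).1)

/-! ## §3 The envelopes `hK0`, `hK1` (every `e ≠ 0`) and `hKs1` (the strip) -/

/-- The signed value envelope at any nonzero loop level: `e ≠ 0 ⟹ |P(e,u)| ≤ (12B₁+9)·(max |e| |u|)⁻¹` (parity for `e < 0`).
[cite: BenfattoGiulianiMastropietro2006, §2.4 (2.36)] -/
theorem abs_ppTrueKernel_le_inv_max_abs {β Λ : ℝ} (hβ : 0 < β) (hΛ : 0 < Λ) {B₁ : ℝ} (hB₁ : ∀ x, |deriv salmhoferCutoff x| ≤ B₁) {e : ℝ} (he : e ≠ 0)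
    (u : ℝ) : |ppTrueKernel β Λ e u| ≤ (12 * B₁ + 9) * (max |e| |u|)⁻¹ := by
  rcases lt_or_gt_of_ne he with hneg | hpos
  · have h := abs_ppTrueKernel_le_inv_max hβ hΛ hB₁ (neg_pos.2 hneg) (-u)
    rw [ppTrueKernel_neg_neg, abs_neg] at h
    rwa [abs_of_neg hneg]
  · rw [abs_of_pos hpos]; exact abs_ppTrueKernel_le_inv_max hβ hΛ hB₁ hpos u

/-- The signed derivative envelope at any nonzero loop level on a support cone: `e ≠ 0`, `0 < c ≤ 1`, `c|e| ≤ |u|` ⟹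
`|∂ᵤP(e,u)| ≤ (64B₂+96B₁+136+(12B₁+9)/c)·(max |e| |u|)⁻¹²`. [cite: BenfattoGiulianiMastropietro2006, §2.4 (2.36)] -/
theorem abs_ppTrueKernelDu_le_inv_max_sq_abs {β Λ : ℝ} (hβ : 0 < β) (hΛ : 0 < Λ) {B₁ B₂ : ℝ} (hB₁ : ∀ x, |deriv salmhoferCutoff x| ≤ B₁)
    (hB₂ : ∀ x, |deriv (deriv salmhoferCutoff) x| ≤ B₂) {c e u : ℝ} (hc : 0 < c) (hc1 : c ≤ 1) (he : e ≠ 0) (hsupp : c * |e| ≤ |u|) :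
    |ppTrueKernelDu β Λ e u| ≤ (64 * B₂ + 96 * B₁ + 136 + (12 * B₁ + 9) / c) * (max |e| |u|)⁻¹ ^ 2 := by
  rcases lt_or_gt_of_ne he with hneg | hpos
  · have hsupp' : c * (-e) ≤ |-u| := by rw [abs_neg]; rwa [abs_of_neg hneg] at hsupp
    have h := abs_ppTrueKernelDu_le_inv_max_sq hβ hΛ hB₁ hB₂ hc hc1 (neg_pos.2 hneg) hsupp'
    rw [ppTrueKernelDu_neg_neg, abs_neg, abs_neg] at h
    rwa [abs_of_neg hneg]
  · rw [abs_of_pos hpos] at hsupp ⊢; exact abs_ppTrueKernelDu_le_inv_max_sq hβ hΛ hB₁ hB₂ hc hc1 hpos hsupp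

/-- **ROW `hK0`**: `e ≠ 0 ⟹ |Kr(e,u)| ≤ κ₀(12B₁+9)·(max |e| |u|)⁻¹` for every `u`. [cite: BenfattoGiulianiMastropietro2006, §2.4 (2.36)] -/
theorem abs_ppFamilyKernel_le {β Λ : ℝ} (hβ : 0 < β) (hΛ : 0 < Λ) {B₁ : ℝ} (hB₁ : ∀ x, |deriv salmhoferCutoff x| ≤ B₁) {κ : ℝ → ℝ} {κ₀ : ℝ}
    (hκb : ∀ t ∈ Icc 0 1, |κ t| ≤ κ₀) {lo : ℝ} (hlo : 0 < lo) {e : ℝ} (he : e ≠ 0) (u : ℝ) :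
    |ppFamilyKernel β Λ κ lo e u| ≤ κ₀ * (12 * B₁ + 9) * (max |e| |u|)⁻¹ := by
  have hB0 := salmhoferB₁_nonneg hB₁
  have hm := (familyScale_pos hlo e).1
  have hM : 0 < max |e| |u| := lt_max_of_lt_left (abs_pos.2 he)
  unfold ppFamilyKernel
  rw [abs_mul]
  have hP := abs_ppTrueKernel_le_inv_max_abs hβ hΛ hB₁ he u
  have hk := hκb _ (splitArg_mem hm u).2.2
  calc |ppTrueKernel β Λ e u| * |κ (familyScale lo e / (familyScale lo e + |u|))| ≤ (12 * B₁ + 9) * (max |e| |u|)⁻¹ * κ₀ :=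
        mul_le_mul hP hk (abs_nonneg _) (by positivity)
    _ = κ₀ * (12 * B₁ + 9) * (max |e| |u|)⁻¹ := by ring

/-- **ROW `hK1`**: `e ≠ 0 ⟹ |deriv Kr(e,·) u| ≤ (κ₀(64B₂+96B₁+136+(12B₁+9)/c) + κ₁(12B₁+9))·(max |e| |u|)⁻¹²`, `c = min(1,(1−t₁)/t₁)`, for every `u` —
on the split's support `c·m ≤ |u|` (`splitWeight_ne_zero_support` at scale `m ≥ |e|`), off it the `∂ᵤP`-term vanishes; `|S′| ≤ κ₁(max m |u|)⁻¹ ≤ κ₁(max |e| |u|)⁻¹`.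
[cite: BenfattoGiulianiMastropietro2006, §2.4 (2.36)] -/
theorem abs_deriv_ppFamilyKernel_le {β Λ : ℝ} (hβ : 0 < β) (hΛ : 0 < Λ) {B₁ B₂ : ℝ} (hB₁ : ∀ x, |deriv salmhoferCutoff x| ≤ B₁)
    (hB₂ : ∀ x, |deriv (deriv salmhoferCutoff) x| ≤ B₂) {κ κ' : ℝ → ℝ} {κ₀ κ₁ t₁ : ℝ} (hκ : ∀ t, HasDerivAt κ (κ' t) t)
    (hκb : ∀ t ∈ Icc 0 1, |κ t| ≤ κ₀) (hκ'b : ∀ t ∈ Icc 0 1, |κ' t| ≤ κ₁) (ht₀ : 0 < t₁) (ht₁ : t₁ < 1) (hκs : ∀ t, t₁ ≤ t → κ t = 0)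
    {lo : ℝ} (hlo : 0 < lo) {e : ℝ} (he : e ≠ 0) (u : ℝ) :
    |deriv (fun v : ℝ => ppFamilyKernel β Λ κ lo e v) u| ≤
      (κ₀ * (64 * B₂ + 96 * B₁ + 136 + (12 * B₁ + 9) / min 1 ((1 - t₁) / t₁)) + κ₁ * (12 * B₁ + 9)) * (max |e| |u|)⁻¹ ^ 2 := by
  have hB0 := salmhoferB₁_nonneg hB₁
  have hB20 : 0 ≤ B₂ := (abs_nonneg _).trans (hB₂ 0)
  have hκ₀ : 0 ≤ κ₀ := (abs_nonneg _).trans (hκb 0 (left_mem_Icc.2 zero_le_one))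
  have hκ₁ : 0 ≤ κ₁ := (abs_nonneg _).trans (hκ'b 0 (left_mem_Icc.2 zero_le_one))
  obtain ⟨hm, hem, _⟩ := familyScale_pos hlo e
  have he0 : 0 < |e| := abs_pos.2 he
  have hM : 0 < max |e| |u| := lt_max_of_lt_left he0
  set c : ℝ := min 1 ((1 - t₁) / t₁) with hc
  have hc0 : 0 < c := lt_min one_pos (div_pos (by linarith) ht₀)
  have hc1 : c ≤ 1 := min_le_left _ _
  set C₁ : ℝ := 64 * B₂ + 96 * B₁ + 136 + (12 * B₁ + 9) / c with hC₁
  have hC₁0 : 0 ≤ C₁ := by positivity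
  rw [deriv_ppFamilyKernel hβ hΛ hB₁ hκ ht₁ hκs hlo]
  -- the split factor and its derivative at scale `m`
  have hk : |κ (familyScale lo e / (familyScale lo e + |u|))| ≤ κ₀ := hκb _ (splitArg_mem hm u).2.2
  have hS' : |deriv (fun v : ℝ => κ (familyScale lo e / (familyScale lo e + |v|))) u| ≤ κ₁ * (max |e| |u|)⁻¹ := by
    refine (abs_deriv_splitWeight_le hκ hκ'b ht₁ hκs hm u).trans (mul_le_mul_of_nonneg_left ?_ hκ₁)
    exact inv_anti₀ hM (max_le_max hem le_rfl)
  -- the `∂ᵤP·S` term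
  have hA : |ppTrueKernelDu β Λ e u * κ (familyScale lo e / (familyScale lo e + |u|))| ≤ κ₀ * C₁ * (max |e| |u|)⁻¹ ^ 2 := by
    by_cases hSz : κ (familyScale lo e / (familyScale lo e + |u|)) = 0
    · rw [hSz, mul_zero, abs_zero]; positivity
    · have hsuppm := splitWeight_ne_zero_support hm ht₀ hκs hSz
      have hsupp : c * |e| ≤ |u| := le_trans (mul_le_mul_of_nonneg_left hem hc0.le) hsuppm
      have hP' := abs_ppTrueKernelDu_le_inv_max_sq_abs hβ hΛ hB₁ hB₂ hc0 hc1 he hsupp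
      rw [abs_mul]
      calc |ppTrueKernelDu β Λ e u| * |κ (familyScale lo e / (familyScale lo e + |u|))| ≤ C₁ * (max |e| |u|)⁻¹ ^ 2 * κ₀ :=
            mul_le_mul hP' hk (abs_nonneg _) (by positivity)
        _ = κ₀ * C₁ * (max |e| |u|)⁻¹ ^ 2 := by ring
  -- the `P·S′` term
  have hB : |ppTrueKernel β Λ e u * deriv (fun v : ℝ => κ (familyScale lo e / (familyScale lo e + |v|))) u| ≤
      κ₁ * (12 * B₁ + 9) * (max |e| |u|)⁻¹ ^ 2 := by
    rw [abs_mul]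
    have hP := abs_ppTrueKernel_le_inv_max_abs hβ hΛ hB₁ he u
    calc |ppTrueKernel β Λ e u| * |deriv (fun v : ℝ => κ (familyScale lo e / (familyScale lo e + |v|))) u|
        ≤ (12 * B₁ + 9) * (max |e| |u|)⁻¹ * (κ₁ * (max |e| |u|)⁻¹) := mul_le_mul hP hS' (abs_nonneg _) (by positivity)
      _ = κ₁ * (12 * B₁ + 9) * (max |e| |u|)⁻¹ ^ 2 := by ring
  calc |ppTrueKernelDu β Λ e u * κ (familyScale lo e / (familyScale lo e + |u|)) +
          ppTrueKernel β Λ e u * deriv (fun v : ℝ => κ (familyScale lo e / (familyScale lo e + |v|))) u|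
      ≤ κ₀ * C₁ * (max |e| |u|)⁻¹ ^ 2 + κ₁ * (12 * B₁ + 9) * (max |e| |u|)⁻¹ ^ 2 := (abs_add_le _ _).trans (add_le_add hA hB)
    _ = (κ₀ * C₁ + κ₁ * (12 * B₁ + 9)) * (max |e| |u|)⁻¹ ^ 2 := by ring

/-- **ROW `hKs1` — THE STRIP**: `0 < lo ≤ Λ`, `|e| ≤ lo` ⟹ `|deriv Kr(e,·) u| ≤ (κ₀(128B₁+72) + 8κ₁)·(max lo |u|)⁻¹²` for every `u` (on the strip the split is
floored at `lo`: `m = lo`, so `|S′| ≤ κ₁(max lo |u|)⁻¹`; `∂ᵤP` and `P` by the strip envelopes of p686140 and §1). [cite: BenfattoGiulianiMastropietro2006, §2.4 (2.36)] -/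
theorem abs_deriv_ppFamilyKernel_strip_le {β Λ : ℝ} (hβ : 0 < β) (hΛ : 0 < Λ) {B₁ : ℝ} (hB₁ : ∀ x, |deriv salmhoferCutoff x| ≤ B₁) {κ κ' : ℝ → ℝ}
    {κ₀ κ₁ t₁ : ℝ} (hκ : ∀ t, HasDerivAt κ (κ' t) t) (hκb : ∀ t ∈ Icc 0 1, |κ t| ≤ κ₀) (hκ'b : ∀ t ∈ Icc 0 1, |κ' t| ≤ κ₁) (ht₁ : t₁ < 1)
    (hκs : ∀ t, t₁ ≤ t → κ t = 0) {lo : ℝ} (hlo : 0 < lo) (hloΛ : lo ≤ Λ) {e : ℝ} (he : |e| ≤ lo) (u : ℝ) :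
    |deriv (fun v : ℝ => ppFamilyKernel β Λ κ lo e v) u| ≤ (κ₀ * (128 * B₁ + 72) + 8 * κ₁) * (max lo |u|)⁻¹ ^ 2 := by
  have hB0 := salmhoferB₁_nonneg hB₁
  have hκ₀ : 0 ≤ κ₀ := (abs_nonneg _).trans (hκb 0 (left_mem_Icc.2 zero_le_one))
  have hκ₁ : 0 ≤ κ₁ := (abs_nonneg _).trans (hκ'b 0 (left_mem_Icc.2 zero_le_one))
  have hmlo : familyScale lo e = lo := familyScale_eq_floor he
  have heΛ : |e| ≤ Λ := he.trans hloΛ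
  have hM0 : 0 < max lo |u| := lt_max_of_lt_left hlo
  have hMΛ : (max Λ |u|)⁻¹ ≤ (max lo |u|)⁻¹ := inv_anti₀ hM0 (max_le_max hloΛ le_rfl)
  rw [deriv_ppFamilyKernel hβ hΛ hB₁ hκ ht₁ hκs hlo, hmlo]
  have hk : |κ (lo / (lo + |u|))| ≤ κ₀ := hκb _ (splitArg_mem hlo u).2.2
  have hS' : |deriv (fun v : ℝ => κ (lo / (lo + |v|))) u| ≤ κ₁ * (max lo |u|)⁻¹ := abs_deriv_splitWeight_le hκ hκ'b ht₁ hκs hlo u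
  have hP' := abs_ppTrueKernelDu_strip_le_inv_max_sq hβ hΛ hB₁ heΛ u
  have hP := abs_ppTrueKernel_strip_le_inv_max hβ hΛ heΛ u
  have hA : |ppTrueKernelDu β Λ e u * κ (lo / (lo + |u|))| ≤ κ₀ * (128 * B₁ + 72) * (max lo |u|)⁻¹ ^ 2 := by
    rw [abs_mul]
    calc |ppTrueKernelDu β Λ e u| * |κ (lo / (lo + |u|))| ≤ (128 * B₁ + 72) * (max Λ |u|)⁻¹ ^ 2 * κ₀ := mul_le_mul hP' hk (abs_nonneg _) (by positivity)
      _ ≤ (128 * B₁ + 72) * (max lo |u|)⁻¹ ^ 2 * κ₀ := by gcongr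
      _ = κ₀ * (128 * B₁ + 72) * (max lo |u|)⁻¹ ^ 2 := by ring
  have hB : |ppTrueKernel β Λ e u * deriv (fun v : ℝ => κ (lo / (lo + |v|))) u| ≤ 8 * κ₁ * (max lo |u|)⁻¹ ^ 2 := by
    rw [abs_mul]
    calc |ppTrueKernel β Λ e u| * |deriv (fun v : ℝ => κ (lo / (lo + |v|))) u| ≤ 8 * (max Λ |u|)⁻¹ * (κ₁ * (max lo |u|)⁻¹) :=
          mul_le_mul hP hS' (abs_nonneg _) (by positivity)
      _ ≤ 8 * (max lo |u|)⁻¹ * (κ₁ * (max lo |u|)⁻¹) := by gcongr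
      _ = 8 * κ₁ * (max lo |u|)⁻¹ ^ 2 := by ring
  calc |ppTrueKernelDu β Λ e u * κ (lo / (lo + |u|)) + ppTrueKernel β Λ e u * deriv (fun v : ℝ => κ (lo / (lo + |v|))) u|
      ≤ κ₀ * (128 * B₁ + 72) * (max lo |u|)⁻¹ ^ 2 + 8 * κ₁ * (max lo |u|)⁻¹ ^ 2 := (abs_add_le _ _).trans (add_le_add hA hB)
    _ = (κ₀ * (128 * B₁ + 72) + 8 * κ₁) * (max lo |u|)⁻¹ ^ 2 := by ring

/-- **ROW `hKs1` in the binder shape of `foldBox_law_rows`** (normalise by the constant). [cite: BenfattoGiulianiMastropietro2006, §2.4 (2.36)] -/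
theorem abs_deriv_ppFamilyKernel_strip_row {β Λ : ℝ} (hβ : 0 < β) (hΛ : 0 < Λ) {B₁ : ℝ} (hB₁ : ∀ x, |deriv salmhoferCutoff x| ≤ B₁) {κ κ' : ℝ → ℝ}
    {κ₀ κ₁ t₁ : ℝ} (hκ : ∀ t, HasDerivAt κ (κ' t) t) (hκb : ∀ t ∈ Icc 0 1, |κ t| ≤ κ₀) (hκ'b : ∀ t ∈ Icc 0 1, |κ' t| ≤ κ₁) (ht₁ : t₁ < 1)
    (hκs : ∀ t, t₁ ≤ t → κ t = 0) {lo : ℝ} (hlo : 0 < lo) (hloΛ : lo ≤ Λ) :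
    ∀ e ∈ Icc (-lo) lo, ∀ u, |deriv (fun v : ℝ => ppFamilyKernel β Λ κ lo e v) u| ≤ (κ₀ * (128 * B₁ + 72) + 8 * κ₁) * (max lo |u|)⁻¹ ^ 2 :=
  fun _ he u => abs_deriv_ppFamilyKernel_strip_le hβ hΛ hB₁ hκ hκb hκ'b ht₁ hκs hlo hloΛ (abs_le.2 ⟨he.1, he.2⟩) u

end Summit.HubbardSuperconductivity.HubbardSuperconductivity.Theorems.C4a

end
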